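import Summits.BirchSwinnertonDyer.BirchSwinnertonDyer.Theorems.UniversalToricDescentResidualCorankOneCriterion
import Mathlib.LinearAlgebra.Dimension.Torsion.Finite
import HarnessLib

/-!
# Route UniversalToricDescent — SUPPLY of the registered stub `stub_howardMuMult`'s `μ`-conjunct from a RESIDUAL
# CORANK-ONE growth bound (node `residual_omega_kolyvagin`, R1), any prime `p`

Lead prover bsd-wall-utd-p1 g22 (`--supports stmt-BirchSwinnertonDyer-24737`, crux `TwinAlgMuZeroAtThree` R2, registered
line `beta-road` v2, skeleton sha16 b25249f0f5715062). The v2 research stub `stub_howardMuMult` asks, besides the rank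
data, for `μ(X_{Λ-tors}) ≤ 2·μ(𝔖/Λκ)` at every non-zero Heegner class `κ`. This file records, as kernel theorems, the two
ways that conjunct is SUPPLIED without any characteristic-ideal divisibility:

* §1 `not_isTorsion_of_finrank_eq_one` — `Λ`-rank one ⟹ not torsion (Mathlib `Module.finrank_eq_zero_iff_isTorsion`).
* §2 `howardMu_of_muInvariant_torsion_eq_zero` — `μ(X_tors) = 0` ⟹ the conjunct (trivially), and
  **`howardMu_of_residual_growth`** — `X` finitely generated of `Λ`-rank one with the residual growth bound
  `#((X/pX) ⧸ T^{pⁿ}) ≤ p^{pⁿ + C}` for all `n` (the X-side form of «`#Sel[p]^{Γ_n} ≤ p^{pⁿ+C}`», i.e. the node's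
  `ResidualCorankLeOne`) ⟹ `μ(X_tors) = 0` (LEAD g21 `…ResidualCorankOne.muInvariant_torsion_eq_zero_of_residual_growth`,
  p733606) ⟹ the conjunct for EVERY `κ`.
* §3 `howardMuMult_tail_of_residual_growth` — the conjunct in the EXACT binder shape of `stub_howardMuMult`'s second
  component (`Module.finrank Λ X = 1 ∧ ∀ κ ∈ ℋ, κ ≠ 0 → …`), so an R1-theorem for bucket B closes that component by `exact`.

THEOREMS ONLY; no `Theses` import; std axioms. BSD is not advanced by this file; stmt-24737 stays open.
References: [Howard2004HeegnerKolyvagin] Thm. B; [GreenbergVatsal2000] §2 Prop. (2.8); [Washington1997] §13.2.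
-/

noncomputable section
open scoped Classical

-- `…BirchSwinnertonDyer.BirchSwinnertonDyer.Theorems…` is the problem's mandated namespace (D-0017).
set_option linter.dupNamespace false
set_option autoImplicit false

namespace Summit.BirchSwinnertonDyer.BirchSwinnertonDyer.Theorems.UniversalToricDescentTwoSidedMuTransfer

open Literature.NumberTheory.EllipticCurves Literature.NumberTheory.EllipticCurves.IwasawaAlgebra
  Literature.NumberTheory.EllipticCurves.Module
  Summit.BirchSwinnertonDyer.BirchSwinnertonDyer.Theorems.UniversalToricDescentResidualCorankOne

variable {p : ℕ} [Fact p.Prime]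

/-! ### §1 Rank one ⟹ not torsion -/

/-- A finitely generated `Λ`-module of `Λ`-rank one is not torsion (`Λ` is a domain). [folklore] -/
theorem not_isTorsion_of_finrank_eq_one {X : Type*} [AddCommGroup X] [Module (IwasawaAlgebra p) X]
    [Module.Finite (IwasawaAlgebra p) X] (hX1 : Module.finrank (IwasawaAlgebra p) X = 1) :
    ¬ Module.IsTorsion (IwasawaAlgebra p) X := fun h => by
  have h0 := (Module.finrank_eq_zero_iff_isTorsion (R := IwasawaAlgebra p) (M := X)).mpr h
  omega

/-! ### §2 The `μ`-conjunct from `μ(X_tors) = 0` and from residual corank-one growth -/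

/-- `μ(X_tors) = 0` ⟹ `μ(X_tors) ≤ 2·μ(𝔖/Λκ)` for every `κ` (the trivial direction; recorded so that skeletons can
`exact` it). [folklore] -/
theorem howardMu_of_muInvariant_torsion_eq_zero {S X : Type*}
    [AddCommGroup S] [Module (IwasawaAlgebra p) S] [AddCommGroup X] [Module (IwasawaAlgebra p) X]
    (hμ : muInvariant p (Submodule.torsion (IwasawaAlgebra p) X) = 0) (κ : S) :
    muInvariant p (Submodule.torsion (IwasawaAlgebra p) X) ≤
      2 * muInvariant p (S ⧸ Submodule.span (IwasawaAlgebra p) {κ}) := by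
  rw [hμ]; exact Nat.zero_le _

/-- **Residual corank-one growth ⟹ the `μ`-conjunct of `stub_howardMuMult`.** For `X` finitely generated of
`Λ`-rank one whose residual layers grow like ONE copy of `Ω = 𝔽_p⟦T⟧` — `#((X/pX) ⧸ T^{pⁿ}·(X/pX)) ≤ p^{pⁿ + C}` for
all `n` — one has `μ(X_{Λ-tors}) = 0` (p733606), hence `μ(X_tors) ≤ 2·μ(𝔖/Λκ)` for every `κ` in any `Λ`-module `𝔖`.
[cite: GreenbergVatsal2000, §2 Prop. (2.8)] [cite: Washington1997, §13.2] -/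
theorem howardMu_of_residual_growth {S X : Type*}
    [AddCommGroup S] [Module (IwasawaAlgebra p) S] [AddCommGroup X] [Module (IwasawaAlgebra p) X]
    [Module.Finite (IwasawaAlgebra p) X] (hX1 : Module.finrank (IwasawaAlgebra p) X = 1) (C : ℕ)
    (hgrowth : ∀ n : ℕ, Nat.card ((X ⧸ (augIdealP p • (⊤ : Submodule (IwasawaAlgebra p) X))) ⧸
      (Ideal.span {((PowerSeries.X : IwasawaAlgebra p) ^ (p ^ n))} •
        (⊤ : Submodule (IwasawaAlgebra p) (X ⧸ (augIdealP p • (⊤ : Submodule (IwasawaAlgebra p) X)))))) ≤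
      p ^ (p ^ n + C))
    (κ : S) :
    muInvariant p (Submodule.torsion (IwasawaAlgebra p) X) ≤
      2 * muInvariant p (S ⧸ Submodule.span (IwasawaAlgebra p) {κ}) :=
  howardMu_of_muInvariant_torsion_eq_zero
    (muInvariant_torsion_eq_zero_of_residual_growth (not_isTorsion_of_finrank_eq_one hX1) C hgrowth) κ

/-! ### §3 The exact tail of `stub_howardMuMult` -/

/-- **The second component of `stub_howardMuMult` from R1-currency**: `Λ`-rank one of `X` and the residual growth bound
give `Module.finrank Λ X = 1 ∧ ∀ κ ∈ ℋ, κ ≠ 0 → μ(X_tors) ≤ 2·μ(𝔖/Λκ)` for ANY submodule `ℋ ≤ 𝔖` (the Heegner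
module in the skeleton). [cite: Howard2004HeegnerKolyvagin, Thm. B] [cite: GreenbergVatsal2000, §2 Prop. (2.8)] -/
theorem howardMuMult_tail_of_residual_growth {S X : Type*}
    [AddCommGroup S] [Module (IwasawaAlgebra p) S] [AddCommGroup X] [Module (IwasawaAlgebra p) X]
    [Module.Finite (IwasawaAlgebra p) X] (hX1 : Module.finrank (IwasawaAlgebra p) X = 1) (C : ℕ)
    (hgrowth : ∀ n : ℕ, Nat.card ((X ⧸ (augIdealP p • (⊤ : Submodule (IwasawaAlgebra p) X))) ⧸
      (Ideal.span {((PowerSeries.X : IwasawaAlgebra p) ^ (p ^ n))} •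
        (⊤ : Submodule (IwasawaAlgebra p) (X ⧸ (augIdealP p • (⊤ : Submodule (IwasawaAlgebra p) X)))))) ≤
      p ^ (p ^ n + C))
    (H : Submodule (IwasawaAlgebra p) S) :
    Module.finrank (IwasawaAlgebra p) X = 1 ∧
      ∀ κ ∈ H, κ ≠ 0 →
        muInvariant p (Submodule.torsion (IwasawaAlgebra p) X) ≤
          2 * muInvariant p (S ⧸ Submodule.span (IwasawaAlgebra p) {κ}) :=
  ⟨hX1, fun κ _ _ => howardMu_of_residual_growth hX1 C hgrowth κ⟩

end Summit.BirchSwinnertonDyer.BirchSwinnertonDyer.Theorems.UniversalToricDescentTwoSidedMuTransfer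

end
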